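import Summits.BirchSwinnertonDyer.BirchSwinnertonDyer.Theorems.ClassRecordThreeEulerHalvesAtThreeCartanSupplyTraceTools
import Mathlib.Data.Finset.Prod
import HarnessLib

/-!
# The Gelfand–Graev lattice of a permutation representation: `GG = {φ : X × X → K ∣ φ(x,x) = 0, Σ_y φ(x,y) = 0}` and its trace

Helper file `--supports stmt-BirchSwinnertonDyer-23422` (seat `bsd-stepL-tam3-p1` g23, LINE OWNER of crux 23422 `EulerHalvesAtThreeResidualUpperBound`,
line `cartan` v11), serving the registered stub (SUPPLY) `stub_cartanTorusLatticeSupply : CartanCorrespondence.CartanTorusLatticeSupply` via the road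
`HOME/tam3-p1/g23/SUPPLY-ROAD-GG1.md` §1. For `X = ℙ¹(𝔽_q)` with its `GL₂(𝔽_q)`-action the lattice `GG₁ := ker(ℤ[pairs of distinct points] → ℤ[ℙ¹])`
(fibre sums) is the rational Gelfand–Graev module with trivial central character, and `χ_W = χ_{Y_s} − χ_{GG₁}` (principal series) resp.
`χ_W = χ_{GG₁} − χ_{Y_ns}` (cuspidal). THIS FILE is the GENERIC part, for any finite set `X` with at least two elements and any permutation `τ` of `X`
acting diagonally on `X × X`: writing functions on ordered pairs of DISTINCT points with vanishing row sums as
`GG := ker(D) ∩ ker(S) ⊂ K^{X × X}`, `D φ = (x ↦ φ(x,x))` (`= LinearMap.funLeft K K (x ↦ (x,x))`), `S φ = (x ↦ Σ_y φ(x,y))`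
(`= Σ_y LinearMap.funLeft K K (x ↦ (x,y))`), we prove that `(D, S) : K^{X×X} → K^X × K^X` is a SURJECTIVE intertwiner and hence
(`TraceTools.trace_eq_trace_sub_trace_restrict_ker_of_surjective`, `trace_funLeft_perm`, `LinearMap.trace_prodMap'`)
**`tr(τ | GG) = #Fix(τ)² − 2·#Fix(τ)`** (`trace_restrict_pairKer`). With `#Fix` on `ℙ¹(𝔽_q)` from `…CartanSupplyFixedPointsP1` this is
`χ_{GG₁} = q² − 1 ∣ −1 ∣ 0 ∣ 0` on scalar ∣ non-semisimple ∣ split ∣ elliptic classes. No definitions (the maps are written out).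
HONEST FRAMING: generic linear algebra; nothing about SUPPLY, NUM, crux 23422 ∕ 19109 is proved here; BSD is proved for no curve. [folklore]
-/

namespace Summit.BirchSwinnertonDyer.BirchSwinnertonDyer.Theorems.CartanSupply.PairLattice

open Module LinearMap
open Summit.BirchSwinnertonDyer.BirchSwinnertonDyer.Theorems.CartanSupply.TraceTools

set_option linter.dupNamespace false
set_option autoImplicit false

variable {K : Type*} [Field K] {X : Type*} [Fintype X] [DecidableEq X]

/-! ## §1 The two maps `D` (diagonal) and `S` (row sums), pointwise -/

omit [Fintype X] [DecidableEq X] in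
/-- PROVED: `D φ x = φ (x, x)`. [folklore] -/
theorem diag_apply (φ : X × X → K) (x : X) : (LinearMap.funLeft K K (fun x : X => (x, x))) φ x = φ (x, x) := rfl

omit [DecidableEq X] in
/-- PROVED: `S φ x = Σ_y φ (x, y)`. [folklore] -/
theorem rowSum_apply (φ : X × X → K) (x : X) :
    (∑ y : X, LinearMap.funLeft K K (fun x : X => (x, y))) φ x = ∑ y : X, φ (x, y) := by
  rw [LinearMap.sum_apply, Finset.sum_apply]
  rfl

/-! ## §2 Equivariance and surjectivity of `(D, S)` -/

omit [DecidableEq X] in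
/-- PROVED: `(D, S)` intertwines the diagonal action `φ ↦ φ ∘ (τ × τ)` on `K^{X×X}` with `(a, b) ↦ (a ∘ τ, b ∘ τ)` on `K^X × K^X`. [folklore] -/
theorem prod_comp_funLeft (τ : Equiv.Perm X) :
    ((LinearMap.funLeft K K (fun x : X => (x, x))).prod (∑ y : X, LinearMap.funLeft K K (fun x : X => (x, y)))) ∘ₗ
        LinearMap.funLeft K K (τ.prodCongr τ) =
      (LinearMap.prodMap (LinearMap.funLeft K K τ) (LinearMap.funLeft K K τ)) ∘ₗ
        ((LinearMap.funLeft K K (fun x : X => (x, x))).prod (∑ y : X, LinearMap.funLeft K K (fun x : X => (x, y)))) := by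
  apply LinearMap.ext
  intro φ
  apply Prod.ext
  · funext x
    rfl
  · funext x
    show (∑ y : X, LinearMap.funLeft K K (fun x : X => (x, y))) (LinearMap.funLeft K K (τ.prodCongr τ) φ) x =
      ((∑ y : X, LinearMap.funLeft K K (fun x : X => (x, y))) φ) (τ x)
    rw [rowSum_apply, rowSum_apply]
    simp only [LinearMap.funLeft_apply, Equiv.prodCongr_apply, Prod.map]
    exact Equiv.sum_comp τ (fun y => φ (τ x, y))

/-- PROVED: `(D, S)` is surjective as soon as `X` has two distinct elements: given `(a, b)` put `a x` on the diagonal and `b x − a x` at one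
off-diagonal place of each row. [folklore] -/
theorem prod_surjective [Nontrivial X] :
    Function.Surjective
      ((LinearMap.funLeft K K (fun x : X => (x, x))).prod (∑ y : X, LinearMap.funLeft K K (fun x : X => (x, y)))) := by
  classical
  rintro ⟨a, b⟩
  -- a second point in each row
  have hn : ∀ x : X, ∃ y : X, y ≠ x := fun x => exists_ne x
  choose n hn using hn
  set ψ : X × X → K := fun z => if z.2 = z.1 then a z.1 else if z.2 = n z.1 then b z.1 - a z.1 else 0 with hψ
  refine ⟨ψ, ?_⟩
  apply Prod.ext
  · funext x
    show ψ (x, x) = a x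
    simp [hψ]
  · funext x
    show (∑ y : X, LinearMap.funLeft K K (fun x : X => (x, y))) ψ x = b x
    rw [rowSum_apply]
    simp only [hψ]
    -- the row `x` has exactly the two non-zero entries `y = x` and `y = n x`
    rw [Finset.sum_ite, Finset.sum_ite]
    have h1 : (Finset.univ.filter fun y : X => y = x) = {x} := by
      ext y; simp
    have h2 : ((Finset.univ.filter fun y : X => ¬ y = x).filter fun y : X => y = n x) = {n x} := by
      ext y
      simp only [Finset.mem_filter, Finset.mem_univ, true_and, Finset.mem_singleton]
      constructor
      · rintro ⟨-, h⟩; exact h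
      · rintro rfl; exact ⟨hn x, rfl⟩
    rw [h1, h2, Finset.sum_singleton, Finset.sum_singleton, Finset.sum_const_zero, add_zero]
    ring

/-! ## §3 Fixed points of the diagonal permutation -/

/-- PROVED: `#Fix(τ × τ) = #Fix(τ)²`. [folklore] -/
theorem card_fixed_prodCongr (τ : Equiv.Perm X) :
    (Finset.univ.filter fun z : X × X => (τ.prodCongr τ) z = z).card = (Finset.univ.filter fun x : X => τ x = x).card ^ 2 := by
  rw [sq, ← Finset.card_product, ← Finset.filter_product, ← Finset.univ_product_univ]
  congr 1
  apply Finset.filter_congr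
  intro z _
  rw [Equiv.prodCongr_apply, Prod.map_apply, Prod.ext_iff]

/-! ## §4 The trace on the Gelfand–Graev kernel -/

/-- PROVED — **TRACE ON THE PAIR KERNEL**: for a permutation `τ` of a finite set `X` with at least two elements, the diagonal action on
`GG = {φ : X × X → K ∣ φ(x,x) = 0, Σ_y φ(x,y) = 0} = ker (D, S)` has trace `#Fix(τ)² − 2·#Fix(τ)`. [folklore] -/
theorem trace_restrict_pairKer [Nontrivial X] (τ : Equiv.Perm X) :
    LinearMap.trace K _ ((LinearMap.funLeft K K (τ.prodCongr τ)).restrict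
        (mapsTo_ker_of_comp_eq _ _ _ (prod_comp_funLeft (K := K) τ))) =
      ((Finset.univ.filter fun x : X => τ x = x).card : K) ^ 2 - 2 * ((Finset.univ.filter fun x : X => τ x = x).card : K) := by
  have h := trace_eq_trace_sub_trace_restrict_ker_of_surjective _ _ _ (prod_comp_funLeft (K := K) τ) prod_surjective
  -- `tr gW = 2·#Fix`, `tr gV = #Fix²`
  rw [LinearMap.trace_prodMap', trace_funLeft_perm, trace_funLeft_perm (K := K) (τ.prodCongr τ), card_fixed_prodCongr] at h
  have h' := h
  push_cast at h' ⊢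
  linear_combination h'

end Summit.BirchSwinnertonDyer.BirchSwinnertonDyer.Theorems.CartanSupply.PairLattice
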